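import Literature.Topology.FourManifolds.GeneralPush
import Literature.Topology.FourManifolds.FoldChartSigCritical
import Literature.Topology.FourManifolds.RankOneFoldPoint
import Mathlib.Analysis.Calculus.BumpFunction.FiniteDimension
import HarnessLib

/-!
# Fold pieces: the static data of a push along a piece of fold arc

Topic `Literature/Topology/FourManifolds` (programme of the fact
`Literature.Topology.FourManifolds.exists_isSimplifiedBrokenLefschetzFibration`, Baykur–Saeki 2017, §2.1
p. 6, §3).  A **fold piece** of scale `r` is a fold chart `(φ, ψ)` of the initial generic map
`g₀` (`ψ ∘ g₀ = F₀ ∘ φ` on `φ.source`) whose target contains the box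
`{|y₀| ≤ 3r/4, ‖x‖ ≤ 3r/4}`.  From it we build the data of a general push (`GeneralPush`):

* the `X`-cutoff `k = β_t(y₀) β_f(x)` (in the chart `φ`; `≡ 1` on the tube
  `|y₀| ≤ 12r/32, ‖x‖ ≤ 4r/32`, supported in `|y₀| ≤ 16r/32, ‖x‖ ≤ 8r/32`),
* the plane bump `ρ = β_a(w₀) β_b(w₁)` (`≡ 1` on `|w₀| ≤ 9r/32, |w₁| ≤ r`, supported in
  `|w₀| ≤ 10r/32`),
* the core arc `κ(t) = φ⁻¹(t e₀)`, the compact chart region `Wbar = φ⁻¹{|y₀| ≤ 23r/32,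
  ‖x‖ ≤ 12r/32}`,

and prove their smoothness / support / value properties.  All radii are fixed fractions of `r`
(multiples of `r/32`), so that the only parameters of a piece are `(φ, ψ, r)`.

Everything is proved; the definitions are the explicit bumps and sets; no named facts
(D-0026).

## References

* R. İ. Baykur, O. Saeki, *Simplifying indefinite fibrations on 4-manifolds*, arXiv:1705.11169,
  §2.1 p. 6, §3. [BaykurSaeki2017]
* M. Golubitsky, V. Guillemin, *Stable Mappings and Their Singularities*, GTM 14 (1973), Ch. III
  §4. [GolubitskyGuillemin1973]
-/

noncomputable section

set_option maxSynthPendingDepth 2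

open Set Function Filter Module Metric
open scoped ContDiff Topology Manifold

namespace Literature.Topology.FourManifolds

/-- Local notation: `𝔼 n` is the model Euclidean space `EuclideanSpace ℝ (Fin n)`. -/
local notation "𝔼 " n:arg => EuclideanSpace ℝ (Fin n)

namespace FoldPiece

variable {X : Type*} [TopologicalSpace X] [ChartedSpace (𝔼 4) X]
  {B : Type*} [TopologicalSpace B] [ChartedSpace (𝔼 2) B]

/-! ### The bumps -/

/-- The `t`-direction cutoff: `1` for `|t| ≤ 12r/32`, `0` for `|t| ≥ 16r/32`. [folklore] -/
def tBump {r : ℝ} (hr : 0 < r) : ContDiffBump (0 : ℝ) :=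
  ⟨12 * r / 32, 16 * r / 32, by positivity, by linarith⟩

/-- The fibre cutoff: `1` for `‖x‖ ≤ 4r/32`, `0` for `‖x‖ ≥ 8r/32`. [folklore] -/
def fBump {r : ℝ} (hr : 0 < r) : ContDiffBump (0 : 𝔼 3) :=
  ⟨4 * r / 32, 8 * r / 32, by positivity, by linarith⟩

/-- The value cutoff along the image arc: `1` for `|w₀| ≤ 9r/32`, `0` for `|w₀| ≥ 10r/32`.
[folklore] -/
def aBump {r : ℝ} (hr : 0 < r) : ContDiffBump (0 : ℝ) :=
  ⟨9 * r / 32, 10 * r / 32, by positivity, by linarith⟩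

/-- The value cutoff across the image arc: `1` for `|w₁| ≤ r`, `0` for `|w₁| ≥ 2r`. [folklore] -/
def bBump {r : ℝ} (hr : 0 < r) : ContDiffBump (0 : ℝ) :=
  ⟨r, 2 * r, hr, by linarith⟩

/-- **The `X`-cutoff** `k(q) = β_t(φ(q)₀) β_f(x(φ q))` on `φ.source`, `0` elsewhere.
[cite: BaykurSaeki2017, §3] -/
def kFun (φ : OpenPartialHomeomorph X (𝔼 4)) {r : ℝ} (hr : 0 < r) : X → ℝ := by
  classical
  exact φ.source.piecewise (fun q => tBump hr (φ q 0) * fBump hr (fibrePart (φ q))) 0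

/-- **The plane bump** `ρ(w) = β_a(w₀) β_b(w₁)`. [cite: BaykurSaeki2017, §3] -/
def ρFun {r : ℝ} (hr : 0 < r) : 𝔼 2 → ℝ := fun w => aBump hr (w 0) * bBump hr (w 1)

/-- **The bump of the push**: `b = (ρ ∘ ψ ∘ g) · k`. [cite: BaykurSaeki2017, §3] -/
def bFun (g : X → B) (φ : OpenPartialHomeomorph X (𝔼 4)) (ψ : OpenPartialHomeomorph B (𝔼 2))
    {r : ℝ} (hr : 0 < r) : X → ℝ :=
  fun q => ρFun hr (ψ (g q)) * kFun φ hr q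

/-- **The core arc** `κ(t) = φ⁻¹(t e₀)`. [folklore] -/
def coreArc (φ : OpenPartialHomeomorph X (𝔼 4)) : ℝ → X :=
  fun t => φ.symm (t • EuclideanSpace.single (0 : Fin 4) (1 : ℝ))

/-- The closed chart box `{|y₀| ≤ a, ‖x‖ ≤ c}`. [folklore] -/
def cbox (a c : ℝ) : Set (𝔼 4) := {y | |y 0| ≤ a ∧ ‖fibrePart y‖ ≤ c}

/-- **The compact chart region** `Wbar = φ⁻¹{|y₀| ≤ 23r/32, ‖x‖ ≤ 12r/32}`. [folklore] -/
def Wbar (φ : OpenPartialHomeomorph X (𝔼 4)) (r : ℝ) : Set X :=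
  φ.symm '' cbox (23 * r / 32) (12 * r / 32)

/-- **The open chart region** `Wo = φ⁻¹{|y₀| < 22r/32, ‖x‖ < 12r/32}`. [folklore] -/
def Wo (φ : OpenPartialHomeomorph X (𝔼 4)) (r : ℝ) : Set X :=
  φ.source ∩ φ ⁻¹' {y | |y 0| < 22 * r / 32 ∧ ‖fibrePart y‖ < 12 * r / 32}

/-- **The factorisation set** `V = φ⁻¹{|y₀| < 12r/32, ‖x‖ < 4r/32} ∩ g⁻¹(ψ.source)`. [folklore] -/
def Vset (g : X → B) (φ : OpenPartialHomeomorph X (𝔼 4)) (ψ : OpenPartialHomeomorph B (𝔼 2))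
    (r : ℝ) : Set X :=
  φ.source ∩ φ ⁻¹' {y | |y 0| < 12 * r / 32 ∧ ‖fibrePart y‖ < 4 * r / 32} ∩ g ⁻¹' ψ.source

/-! ### The closed box is compact -/

/-- The closed box is the image of a compact product under `unfibre`. [folklore] -/
theorem cbox_eq (a c : ℝ) : cbox a c = unfibre '' (closedBall (0 : ℝ) a ×ˢ closedBall (0 : 𝔼 3) c) := by
  ext y
  simp only [cbox, mem_setOf_eq, mem_image, mem_prod, mem_closedBall, dist_zero_right,
    Real.norm_eq_abs, Prod.exists]
  constructor
  · rintro ⟨h0, h1⟩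
    exact ⟨y 0, fibrePart y, ⟨h0, h1⟩, unfibre_fibrePart y⟩
  · rintro ⟨a', x, ⟨ha', hx⟩, rfl⟩
    refine ⟨by simpa using ha', ?_⟩
    rw [fibrePart_unfibre]; exact hx

/-- The closed box is compact. [folklore] -/
theorem isCompact_cbox (a c : ℝ) : IsCompact (cbox a c) := by
  rw [cbox_eq]
  exact ((isCompact_closedBall _ _).prod (isCompact_closedBall _ _)).image unfibre.continuous

/-- The closed box is closed. [folklore] -/
theorem isClosed_cbox (a c : ℝ) : IsClosed (cbox a c) := (isCompact_cbox a c).isClosed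

/-- Monotonicity of boxes. [folklore] -/
theorem cbox_mono {a a' c c' : ℝ} (ha : a ≤ a') (hc : c ≤ c') : cbox a c ⊆ cbox a' c' :=
  fun _ hy => ⟨hy.1.trans ha, hy.2.trans hc⟩

/-! ### The plane bump -/

section Rho

variable {r : ℝ} (hr : 0 < r)

/-- `ρ` is `C^∞`. [folklore] -/
theorem contDiff_ρFun : ContDiff ℝ ∞ (ρFun hr) :=
  ((aBump hr).contDiff.comp (EuclideanSpace.proj (0 : Fin 2)).contDiff).mul
    ((bBump hr).contDiff.comp (EuclideanSpace.proj (1 : Fin 2)).contDiff)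

/-- `0 ≤ ρ ≤ 1`. [folklore] -/
theorem ρFun_mem_Icc (w : 𝔼 2) : ρFun hr w ∈ Icc (0 : ℝ) 1 :=
  ⟨mul_nonneg (aBump hr).nonneg (bBump hr).nonneg,
    mul_le_one₀ (aBump hr).le_one (bBump hr).nonneg (bBump hr).le_one⟩

/-- `ρ = 1` on `{|w₀| ≤ 9r/32, |w₁| ≤ r}`. [folklore] -/
theorem ρFun_eq_one {w : 𝔼 2} (h0 : |w 0| ≤ 9 * r / 32) (h1 : |w 1| ≤ r) : ρFun hr w = 1 := by
  rw [ρFun, (aBump hr).one_of_mem_closedBall, (bBump hr).one_of_mem_closedBall, one_mul]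
  · simpa [bBump] using h1
  · simpa [aBump] using h0

/-- `ρ` is supported in `{|w₀| ≤ 10r/32, |w₁| ≤ 2r}`. [folklore] -/
theorem tsupport_ρFun_subset :
    tsupport (ρFun hr) ⊆ {w : 𝔼 2 | |w 0| ≤ 10 * r / 32 ∧ |w 1| ≤ 2 * r} := by
  have hcl : IsClosed {w : 𝔼 2 | |w 0| ≤ 10 * r / 32 ∧ |w 1| ≤ 2 * r} :=
    (isClosed_le (continuous_abs.comp (EuclideanSpace.proj (0 : Fin 2)).continuous)
      continuous_const).inter
      (isClosed_le (continuous_abs.comp (EuclideanSpace.proj (1 : Fin 2)).continuous)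
        continuous_const)
  refine closure_minimal (fun w hw => ?_) hcl
  rw [mem_support, ρFun, mul_ne_zero_iff] at hw
  constructor
  · have h := (aBump hr).support_eq ▸ (mem_support.2 hw.1)
    rw [mem_ball, dist_zero_right, Real.norm_eq_abs] at h
    exact (le_of_lt h).trans (by simp [aBump])
  · have h := (bBump hr).support_eq ▸ (mem_support.2 hw.2)
    rw [mem_ball, dist_zero_right, Real.norm_eq_abs] at h
    exact (le_of_lt h).trans (by simp [bBump])

/-- `ρ` has compact support. [folklore] -/
theorem hasCompactSupport_ρFun : HasCompactSupport (ρFun hr) := by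
  have h1 : tsupport (ρFun hr) ⊆ closedBall (0 : 𝔼 2) (10 * r / 32 + 2 * r) := by
    intro w hw
    obtain ⟨h0, h1⟩ := tsupport_ρFun_subset hr hw
    rw [mem_closedBall, dist_zero_right, EuclideanSpace.norm_eq]
    have hsum : ∑ i : Fin 2, ‖w i‖ ^ 2 = |w 0| ^ 2 + |w 1| ^ 2 := by
      simp [Fin.sum_univ_two, Real.norm_eq_abs]
    rw [hsum]
    calc Real.sqrt (|w 0| ^ 2 + |w 1| ^ 2) ≤ Real.sqrt ((|w 0| + |w 1|) ^ 2) := by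
          gcongr; nlinarith [abs_nonneg (w 0), abs_nonneg (w 1)]
      _ = |w 0| + |w 1| := Real.sqrt_sq (by positivity)
      _ ≤ 10 * r / 32 + 2 * r := add_le_add h0 h1
  exact HasCompactSupport.of_support_subset_isCompact (isCompact_closedBall _ _)
    (subset_tsupport _ |>.trans h1)

/-- Outside `{|w₀| ≤ 10r/32}` the bump `ρ` vanishes identically near the point. [folklore] -/
theorem ρFun_eventuallyEq_zero {w : 𝔼 2} (hw : 10 * r / 32 < |w 0|) : ρFun hr =ᶠ[𝓝 w] 0 := by
  rw [← notMem_tsupport_iff_eventuallyEq]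
  intro h
  exact not_le.2 hw (tsupport_ρFun_subset hr h).1

end Rho

/-! ### The `X`-cutoff -/

section K

variable {φ : OpenPartialHomeomorph X (𝔼 4)} {r : ℝ} (hr : 0 < r)

omit [ChartedSpace (𝔼 4) X] in
/-- On `φ.source`. [folklore] -/
theorem kFun_of_mem {q : X} (hq : q ∈ φ.source) :
    kFun φ hr q = tBump hr (φ q 0) * fBump hr (fibrePart (φ q)) := by
  classical
  unfold kFun
  exact piecewise_eq_of_mem _ _ _ hq

omit [ChartedSpace (𝔼 4) X] in
/-- Off `φ.source`. [folklore] -/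
theorem kFun_of_notMem {q : X} (hq : q ∉ φ.source) : kFun φ hr q = 0 := by
  classical
  unfold kFun
  exact piecewise_eq_of_notMem _ _ _ hq

omit [ChartedSpace (𝔼 4) X] in
/-- `0 ≤ k ≤ 1`. [folklore] -/
theorem kFun_mem_Icc (q : X) : kFun φ hr q ∈ Icc (0 : ℝ) 1 := by
  by_cases hq : q ∈ φ.source
  · rw [kFun_of_mem hr hq]
    exact ⟨mul_nonneg (tBump hr).nonneg (fBump hr).nonneg,
      mul_le_one₀ (tBump hr).le_one (fBump hr).nonneg (fBump hr).le_one⟩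
  · rw [kFun_of_notMem hr hq]; exact ⟨le_rfl, zero_le_one⟩

omit [ChartedSpace (𝔼 4) X] in
/-- `k = 1` on the tube `φ⁻¹{|y₀| ≤ 12r/32, ‖x‖ ≤ 4r/32}`. [folklore] -/
theorem kFun_eq_one {q : X} (hq : q ∈ φ.source) (h0 : |φ q 0| ≤ 12 * r / 32)
    (h1 : ‖fibrePart (φ q)‖ ≤ 4 * r / 32) : kFun φ hr q = 1 := by
  rw [kFun_of_mem hr hq, (tBump hr).one_of_mem_closedBall, (fBump hr).one_of_mem_closedBall,
    one_mul]
  · simpa [fBump] using h1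
  · simpa [tBump] using h0

omit [ChartedSpace (𝔼 4) X] in
/-- The support of `k` lies in `φ⁻¹(cbox (16r/32) (8r/32))`. [folklore] -/
theorem support_kFun_subset :
    support (kFun φ hr) ⊆ φ.source ∩ φ ⁻¹' cbox (16 * r / 32) (8 * r / 32) := by
  intro q hq
  rw [mem_support] at hq
  by_cases hqs : q ∈ φ.source
  · rw [kFun_of_mem hr hqs, mul_ne_zero_iff] at hq
    refine ⟨hqs, ?_, ?_⟩
    · have h := (tBump hr).support_eq ▸ (mem_support.2 hq.1)
      rw [mem_ball, dist_zero_right, Real.norm_eq_abs] at h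
      exact (le_of_lt h).trans (by simp [tBump])
    · have h := (fBump hr).support_eq ▸ (mem_support.2 hq.2)
      rw [mem_ball, dist_zero_right] at h
      exact (le_of_lt h).trans (by simp [fBump])
  · exact absurd (kFun_of_notMem hr hqs) hq

omit [ChartedSpace (𝔼 4) X] in
/-- With the box `cbox (24r/32) (24r/32) ⊆ φ.target`: the support closure of `k` is the
compact set `φ⁻¹(cbox (16r/32) (8r/32)) ⊆ φ.source`. [folklore] -/
theorem tsupport_kFun_subset [T2Space X] (hbox : cbox (24 * r / 32) (24 * r / 32) ⊆ φ.target) :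
    tsupport (kFun φ hr) ⊆ φ.symm '' cbox (16 * r / 32) (8 * r / 32) := by
  have hsub : cbox (16 * r / 32) (8 * r / 32) ⊆ φ.target :=
    (cbox_mono (by linarith) (by linarith)).trans hbox
  have hK : IsCompact (φ.symm '' cbox (16 * r / 32) (8 * r / 32)) :=
    (isCompact_cbox _ _).image_of_continuousOn (φ.continuousOn_symm.mono hsub)
  refine closure_minimal ?_ hK.isClosed
  intro q hq
  obtain ⟨hqs, hqb⟩ := support_kFun_subset hr hq
  exact ⟨φ q, hqb, φ.left_inv hqs⟩

omit [ChartedSpace (𝔼 4) X] in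
/-- `k` has compact support (given the box). [folklore] -/
theorem hasCompactSupport_kFun [T2Space X] (hbox : cbox (24 * r / 32) (24 * r / 32) ⊆ φ.target) :
    HasCompactSupport (kFun φ hr) := by
  have hsub : cbox (16 * r / 32) (8 * r / 32) ⊆ φ.target :=
    (cbox_mono (by linarith) (by linarith)).trans hbox
  exact HasCompactSupport.of_support_subset_isCompact
    ((isCompact_cbox _ _).image_of_continuousOn (φ.continuousOn_symm.mono hsub))
    (subset_tsupport _ |>.trans (tsupport_kFun_subset hr hbox))

omit [ChartedSpace (𝔼 4) X] in
/-- `tsupport k ⊆ φ.source`. [folklore] -/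
theorem tsupport_kFun_subset_source [T2Space X]
    (hbox : cbox (24 * r / 32) (24 * r / 32) ⊆ φ.target) : tsupport (kFun φ hr) ⊆ φ.source := by
  have hsub : cbox (16 * r / 32) (8 * r / 32) ⊆ φ.target :=
    (cbox_mono (by linarith) (by linarith)).trans hbox
  rintro q hq
  obtain ⟨y, hy, rfl⟩ := tsupport_kFun_subset hr hbox hq
  exact φ.map_target (hsub hy)

/-- **`k` is `C^∞`** (given the box and the smoothness of `φ`). [folklore] -/
theorem contMDiff_kFun [T2Space X] (hφ : ContMDiffOn (𝓡 4) (𝓡 4) ∞ φ φ.source)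
    (hbox : cbox (24 * r / 32) (24 * r / 32) ⊆ φ.target) :
    ContMDiff (𝓡 4) 𝓘(ℝ, ℝ) ∞ (kFun φ hr) := by
  have hmodel : ContDiff ℝ ∞ fun y : 𝔼 4 => tBump hr (y 0) * fBump hr (fibrePart y) :=
    ((tBump hr).contDiff.comp (EuclideanSpace.proj (0 : Fin 4)).contDiff).mul
      ((fBump hr).contDiff.comp fibrePart.contDiff)
  have hon : ContMDiffOn (𝓡 4) 𝓘(ℝ, ℝ) ∞ (kFun φ hr) φ.source :=
    ((hmodel.contMDiff.comp_contMDiffOn hφ)).congr fun q hq => kFun_of_mem hr hq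
  intro q
  by_cases hq : q ∈ φ.source
  · exact (hon q hq).contMDiffAt (φ.open_source.mem_nhds hq)
  · exact contMDiffAt_of_notMem (fun h => hq (tsupport_kFun_subset_source hr hbox h)) _

end K

/-! ### The core arc -/

section Core

variable {φ : OpenPartialHomeomorph X (𝔼 4)} {r : ℝ}

/-- `t e₀` lies in the box `cbox a c` iff `|t| ≤ a` (for `c ≥ 0`). [folklore] -/
theorem smul_single_mem_cbox {t a c : ℝ} (hc : 0 ≤ c) (ht : |t| ≤ a) :
    t • EuclideanSpace.single (0 : Fin 4) (1 : ℝ) ∈ cbox a c := by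
  refine ⟨by simpa using ht, ?_⟩
  have : fibrePart (t • EuclideanSpace.single (0 : Fin 4) (1 : ℝ)) = 0 := by
    ext i; fin_cases i <;> simp [fibrePart_apply]
  rw [this, norm_zero]; exact hc

omit [ChartedSpace (𝔼 4) X] in
/-- The core arc at `|t| ≤ 24r/32` is in `φ.source` with `φ(κ t) = t e₀` (given the box). [folklore] -/
theorem coreArc_spec (hr : 0 < r) (hbox : cbox (24 * r / 32) (24 * r / 32) ⊆ φ.target) {t : ℝ}
    (ht : |t| ≤ 24 * r / 32) :
    coreArc φ t ∈ φ.source ∧ φ (coreArc φ t) = t • EuclideanSpace.single (0 : Fin 4) (1 : ℝ) := by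
  have hy : t • EuclideanSpace.single (0 : Fin 4) (1 : ℝ) ∈ φ.target :=
    hbox (smul_single_mem_cbox (by positivity) ht)
  exact ⟨φ.map_target hy, φ.right_inv hy⟩

/-- The core arc is `C^∞` on `(-24r/32, 24r/32)` (given the box and the smoothness of `φ⁻¹`).
[folklore] -/
theorem contMDiffOn_coreArc (hr : 0 < r) (hφs : ContMDiffOn (𝓡 4) (𝓡 4) ∞ φ.symm φ.target)
    (hbox : cbox (24 * r / 32) (24 * r / 32) ⊆ φ.target) :
    ContMDiffOn 𝓘(ℝ, ℝ) (𝓡 4) ∞ (coreArc φ) (Ioo (-(24 * r / 32)) (24 * r / 32)) := by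
  have h1 : ContMDiff 𝓘(ℝ, ℝ) (𝓡 4) ∞ fun t : ℝ => t • EuclideanSpace.single (0 : Fin 4) (1 : ℝ) :=
    (contDiff_id.smul contDiff_const).contMDiff
  refine hφs.comp h1.contMDiffOn fun t ht => hbox (smul_single_mem_cbox (by positivity) ?_)
  rw [abs_le]; exact ⟨ht.1.le, ht.2.le⟩

omit [ChartedSpace (𝔼 4) X] in
/-- `Wbar` is compact (given the box). [folklore] -/
theorem isCompact_Wbar (hr : 0 < r) (hbox : cbox (24 * r / 32) (24 * r / 32) ⊆ φ.target) :
    IsCompact (Wbar φ r) :=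
  (isCompact_cbox _ _).image_of_continuousOn
    (φ.continuousOn_symm.mono ((cbox_mono (by linarith) (by linarith)).trans hbox))

omit [ChartedSpace (𝔼 4) X] in
/-- `Wbar ⊆ φ.source`. [folklore] -/
theorem Wbar_subset_source (hr : 0 < r) (hbox : cbox (24 * r / 32) (24 * r / 32) ⊆ φ.target) :
    Wbar φ r ⊆ φ.source := by
  rintro _ ⟨y, hy, rfl⟩
  exact φ.map_target ((cbox_mono (by linarith) (by linarith)).trans hbox hy)

omit [ChartedSpace (𝔼 4) X] in
/-- Membership in `Wbar` through the chart. [folklore] -/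
theorem mem_Wbar_of {q : X} (hq : q ∈ φ.source) (h : φ q ∈ cbox (23 * r / 32) (12 * r / 32)) :
    q ∈ Wbar φ r :=
  ⟨φ q, h, φ.left_inv hq⟩

omit [ChartedSpace (𝔼 4) X] in
/-- `tsupport k ⊆ Wo`. [folklore] -/
theorem tsupport_kFun_subset_Wo [T2Space X] (hr : 0 < r)
    (hbox : cbox (24 * r / 32) (24 * r / 32) ⊆ φ.target) : tsupport (kFun φ hr) ⊆ Wo φ r := by
  intro q hq
  obtain ⟨y, hy, rfl⟩ := tsupport_kFun_subset hr hbox hq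
  have hyt : y ∈ φ.target := (cbox_mono (by linarith) (by linarith)).trans hbox hy
  refine ⟨φ.map_target hyt, ?_⟩
  rw [mem_preimage, φ.right_inv hyt]
  exact ⟨lt_of_le_of_lt hy.1 (by linarith), lt_of_le_of_lt hy.2 (by linarith)⟩

omit [ChartedSpace (𝔼 4) X] in
/-- `Wo ⊆ Wbar`. [folklore] -/
theorem Wo_subset_Wbar (hr : 0 < r) : Wo φ r ⊆ Wbar φ r := fun q hq =>
  mem_Wbar_of hq.1 ⟨le_of_lt (lt_of_lt_of_le hq.2.1 (by linarith)), hq.2.2.le⟩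

omit [ChartedSpace (𝔼 4) X] in
/-- The core arc at `|t| ≤ 23r/32` lies in `Wbar`. [folklore] -/
theorem coreArc_mem_Wbar (hr : 0 < r) {t : ℝ} (ht : |t| ≤ 23 * r / 32) : coreArc φ t ∈ Wbar φ r :=
  ⟨_, smul_single_mem_cbox (by positivity) ht, rfl⟩

end Core

end FoldPiece

end Literature.Topology.FourManifolds
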